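import Literature.Analysis.FluidPDE.NSViscosityRescaling
import Literature.Analysis.FluidPDE.KNSSTypeIIHolds
import Literature.Analysis.FluidPDE.NSCriticalClosureBesovBounded
import Literature.Analysis.FluidPDE.TaoLocalisationHolds
import Literature.Analysis.FluidPDE.MollifiedSliceTools
import Summits.NavierStokesRegularity.NavierStokesRegularity.Theorems.PlaneEnergyCeilingBoundedPlanarEnergyRegularityZoomLimit
import Summits.NavierStokesRegularity.NavierStokesRegularity.Theorems.PlaneEnergyCeilingBoundedPlanarEnergyRegularityZoomOseenLimit
import Summits.NavierStokesRegularity.NavierStokesRegularity.Theorems.PlaneEnergyCeilingBoundedPlanarEnergyRegularityZoomAncientMild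
import Summits.NavierStokesRegularity.NavierStokesRegularity.Theorems.PlaneEnergyCeilingBoundedPlanarEnergyRegularityPlanarZoom
import HarnessLib

/-!
# Route PlaneEnergyCeiling · crux `BoundedPlanarEnergyRegularity` — the zoom stub
# `stub_planarEnergyZoom` (= support item `PlanarEnergyZoom`, stmt-NavierStokesRegularity-16858)

Helper file for the crux item stmt-NavierStokesRegularity-16921 (`BoundedPlanarEnergyRegularity`,
route `PlaneEnergyCeiling`): it proves, with EXACTLY the registered signature, the zoom stub
`stub_planarEnergyZoom` of the line `Cruxes/BoundedPlanarEnergyRegularity/Lines/birth.lean`, which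
is verbatim the support item `Theses.PlaneEnergyCeiling.PlanarEnergyZoom` (stmt-16858). With the
landed glue `boundedPlanarEnergyRegularity_of_liouville_zoom` /
`planarEnergyZoomA_of_planarEnergyZoom` (`…Glue.lean`) this reduces the crux, and the (A)-form zoom
`PlanarEnergyZoomA` (stmt-16915), to the Liouville item `PlanarEnergyLiouville` (stmt-16856).

**Statement (VELOCITY-RECORD ZOOM AT BOUNDED PLANAR ENERGY, extension form).** If a classical
solution `(u,p)` of unforced NS (`ν > 0`) on `ℝ³ × [0,T)`, Leray–Hopf on `[0,T]` from its rapidly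
decaying datum `u 0`, has no smooth extension past `T` while its planar kinetic energies stay `≤ M`
on `[0,T)` (every plane `R({x₂ = c})`), then there is a bounded ancient mild solution `v` (`ν = 1`,
duality form), with measurable slices, jointly smooth on `(−∞,0) × ℝ³`, with planar energies
`≤ M/ν²` on every plane and every slice `t < 0`, and `v ≢ 0`.

**Proof.** Normalise `ν = 1` (`w(s) = ν⁻¹u(s/ν)`, `IsClassicalNSSolutionOn.viscosityRescale_set`;
planar energies scale by `ν⁻²`). `w` is bounded on `(0, T')` for `T' < νT` (Tao 2013 Cor. 11.1,
`exists_forall_norm_le_of_tao2011`) and NOT bounded on `(0, νT)` (else `u` is bounded on `[0,T)` and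
extends, `hasSmoothExtensionPast_of_bounded_holds`); its slices are in `L²` uniformly (energy
inequality, `IsLerayHopfOn.eLpNorm_le_eLpNorm_datum`). The finite-energy KNSS zoom
(`exists_zoom_limit_of_memLp_two`) gives rescaled velocities `V_n` bounded by `2` converging
pointwise on `(−∞,0] × ℝ³` to a continuous `v ≢ 0`; the limit satisfies the Oseen integral
equation (`zoom_limit_oseen_identity`), its slices are weakly divergence free
(`isWeaklyDivFree_of_tendsto_of_bound`), so it is a bounded ancient mild solution, jointly smooth,
with measurable slices (`zoom_limit_isBoundedAncientMildSolution`); the planar bound passes to `V_n`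
exactly (`planarEnergy_zoom_eq`) and to `v` by Fatou (`planarEnergy_le_of_tendsto`).

References: Koch–Nadirashvili–Seregin–Šverák 2009, §6 (Lemma 6.1, Prop. 6.1 and the proof of
Thm. 6.1); Seregin–Šverák 2009, §1; Albritton–Barker 2019. [KNSS2009] [SereginSverak2009]
-/

noncomputable section

-- single-conjunct summit: `Summit.<Summit>.<Problem>` repeats the name by the D-0017 layout
set_option linter.dupNamespace false

namespace Summit.NavierStokesRegularity.NavierStokesRegularity.Theorems.BoundedPlanarEnergyRegularity

open MeasureTheory Set Function Filter Topology TopologicalSpace Metric WithLp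
open scoped NNReal ENNReal
open Literature.Analysis Literature.Analysis.FluidPDE

/-- **stub `stub_planarEnergyZoom` of the line `birth` = support item `PlanarEnergyZoom`
(stmt-NavierStokesRegularity-16858), proved** (module docstring): velocity-record zoom at bounded
planar energy, extension form — a classical Leray–Hopf solution from a rapidly decaying datum with
no smooth extension past `T` and planar energies `≤ M` on `[0,T)` yields a non-zero bounded ancient
mild solution (`ν = 1`), measurable, jointly smooth on `(−∞,0) × ℝ³`, with planar energies `≤ M/ν²`. -/
theorem stub_planarEnergyZoom :
    ∀ (ν T : ℝ), 0 < ν → 0 < T →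
      ∀ (u : ℝ → EuclideanSpace ℝ (Fin 3) → EuclideanSpace ℝ (Fin 3))
        (p : ℝ → EuclideanSpace ℝ (Fin 3) → ℝ),
        Literature.Analysis.FluidPDE.IsClassicalNSSolutionOn (Set.Ico 0 T) ν 0 u p →
        Literature.Analysis.FluidPDE.IsLerayHopfOn T ν 0 (u 0) u →
        Literature.Analysis.FluidPDE.HasRapidSpatialDecay (u 0) →
        ¬ Literature.Analysis.FluidPDE.HasSmoothExtensionPast ν 0 u T →
        (∃ M : ℝ, ∀ t ∈ Set.Ico 0 T,
          ∀ (R : EuclideanSpace ℝ (Fin 3) ≃ₗᵢ[ℝ] EuclideanSpace ℝ (Fin 3)) (c : ℝ),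
            ∫⁻ y : EuclideanSpace ℝ (Fin 2), ‖u t (R (WithLp.toLp 2 ![y 0, y 1, c]))‖ₑ ^ 2
              ≤ ENNReal.ofReal M) →
        ∃ (v : ℝ → EuclideanSpace ℝ (Fin 3) → EuclideanSpace ℝ (Fin 3)) (M' : ℝ),
          Literature.Analysis.FluidPDE.IsBoundedAncientMildSolution 1 v ∧
          (∀ t < 0, MeasureTheory.AEStronglyMeasurable (v t) MeasureTheory.volume) ∧
          ContDiffOn ℝ (⊤ : ℕ∞) (Function.uncurry v) (Set.Iio 0 ×ˢ Set.univ) ∧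
          (∀ t < 0, ∀ (R : EuclideanSpace ℝ (Fin 3) ≃ₗᵢ[ℝ] EuclideanSpace ℝ (Fin 3)) (c : ℝ),
            ∫⁻ y : EuclideanSpace ℝ (Fin 2), ‖v t (R (WithLp.toLp 2 ![y 0, y 1, c]))‖ₑ ^ 2
              ≤ ENNReal.ofReal M') ∧
          ∃ t < 0, ∃ x, v t x ≠ 0 := by
  intro ν T hν hT u p hcl hLH hdec hne hplanar
  obtain ⟨M, hM⟩ := hplanar
  have hν' : 0 < ν⁻¹ := inv_pos.2 hν
  have hνT : 0 < ν * T := mul_pos hν hT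
  have hu₀2 : MemLp (u 0) 2 volume := hLH.memLp 0 ⟨le_rfl, hT.le⟩
  -- ### Step 1: normalise the viscosity to `1`
  set w : ℝ → EuclideanSpace ℝ (Fin 3) → EuclideanSpace ℝ (Fin 3) := timeRescale ν⁻¹ ν⁻¹ u with hwdef
  set q : ℝ → EuclideanSpace ℝ (Fin 3) → ℝ := timeRescale ν⁻¹ (ν⁻¹ ^ 2) p with hqdef
  have hmaps : MapsTo (fun s => ν⁻¹ * s) (Ioo 0 (ν * T)) (Ioo 0 T) := fun s hs =>
    (inv_mul_mem_Ioo_iff hν).2 hs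
  have hclw : IsClassicalNSSolutionOn (Ioo 0 (ν * T)) 1 0 w q := by
    have h1 := (hcl.mono Ioo_subset_Ico_self (uniqueDiffOn_Ioo 0 T)).viscosityRescale_set hν.ne'
      hmaps (uniqueDiffOn_Ioo 0 (ν * T))
    simpa only [timeRescale_zero_force] using h1
  have hw_apply : ∀ s x, w s x = ν⁻¹ • u (ν⁻¹ * s) x := fun s x => rfl
  -- ### Step 2: `w` is bounded before `νT`, not bounded up to `νT`, with slices in `L²`
  have hbddw : ∀ T' < ν * T, ∃ M₁ : ℝ, ∀ s ∈ Ioo 0 T', ∀ x, ‖w s x‖ ≤ M₁ := by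
    intro T' hT'
    rcases le_or_gt T' 0 with hT'0 | hT'0
    · exact ⟨0, fun s hs _ => absurd (hs.1.trans hs.2) (not_lt.2 hT'0)⟩
    · have hT₁ : ν⁻¹ * T' ∈ Ioo 0 T := (inv_mul_mem_Ioo_iff hν).2 ⟨hT'0, hT'⟩
      obtain ⟨M₁, hM₁⟩ := exists_forall_norm_le_of_tao2011 tao2011_hasBoundedSobolevNormsOn_holds hν
        hcl hLH hdec (ν⁻¹ * T') hT₁
      refine ⟨ν⁻¹ * M₁, fun s hs x => ?_⟩
      rw [hw_apply, norm_smul, Real.norm_eq_abs, abs_of_pos hν']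
      refine mul_le_mul_of_nonneg_left (hM₁ _ ⟨?_, ?_⟩ x) hν'.le
      · exact mul_nonneg hν'.le hs.1.le
      · exact mul_le_mul_of_nonneg_left hs.2.le hν'.le
  have hunbw : ¬ ∃ M₁ : ℝ, ∀ s ∈ Ioo 0 (ν * T), ∀ x, ‖w s x‖ ≤ M₁ := by
    rintro ⟨M₁, hM₁⟩
    -- then `u` is bounded on `[0,T) × ℝ³` and extends past `T`
    obtain ⟨C₀, hC₀⟩ := hdec 0 0
    apply hne
    refine hasSmoothExtensionPast_of_bounded_holds hν hT hcl hLH ⟨max (ν * M₁) C₀, fun t ht x => ?_⟩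
    rcases ht.1.eq_or_lt with h0 | h0
    · rw [← h0]
      have h1 := hC₀ x
      rw [pow_zero, one_mul, norm_iteratedFDeriv_zero] at h1
      exact h1.trans (le_max_right _ _)
    · have hs : ν * t ∈ Ioo 0 (ν * T) := ⟨mul_pos hν h0, mul_lt_mul_of_pos_left ht.2 hν⟩
      have h1 := hM₁ (ν * t) hs x
      rw [hw_apply, ← mul_assoc, inv_mul_cancel₀ hν.ne', one_mul, norm_smul, Real.norm_eq_abs,
        abs_of_pos hν'] at h1
      have h2 : ‖u t x‖ ≤ ν * M₁ := by
        rw [inv_mul_le_iff₀ hν] at h1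
        exact h1
      exact h2.trans (le_max_left _ _)
  have hmem_u : ∀ s ∈ Ioo 0 (ν * T), ν⁻¹ * s ∈ Icc 0 T := fun s hs =>
    ⟨(hmaps hs).1.le, (hmaps hs).2.le⟩
  have hL2w : ∀ s ∈ Ioo 0 (ν * T), MemLp (w s) 2 volume := fun s hs =>
    (hLH.memLp _ (hmem_u s hs)).const_smul ν⁻¹
  set K₀ : ℝ≥0∞ := ENNReal.ofReal ν⁻¹ * eLpNorm (u 0) 2 volume with hK₀
  have hK₀top : K₀ ≠ ⊤ := ENNReal.mul_ne_top ENNReal.ofReal_ne_top hu₀2.eLpNorm_ne_top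
  have hK₀b : ∀ s ∈ Ioo 0 (ν * T), eLpNorm (w s) 2 volume ≤ K₀ := by
    intro s hs
    have h1 : w s = ν⁻¹ • u (ν⁻¹ * s) := rfl
    rw [h1, eLpNorm_const_smul, Real.enorm_eq_ofReal hν'.le, hK₀]
    gcongr
    exact hLH.eLpNorm_le_eLpNorm_datum hν.le hu₀2 (hmem_u s hs)
  -- ### Step 3: the finite-energy zoom and its limit
  obtain ⟨v, tn, xn, c, htn, hcpos, hA, hVbd, hVlim, hvcont, hvbd, -, hnz, -⟩ :=
    exists_zoom_limit_of_memLp_two (ν * T) w q hνT hclw hbddw hunbw hL2w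
  -- the rescaled classical solutions once more (slices continuous and divergence free)
  set V : ℕ → ℝ → EuclideanSpace ℝ (Fin 3) → EuclideanSpace ℝ (Fin 3) :=
    fun n => c n • stPull (c n ^ 2) (c n) (tn n) (xn n) w with hVdef
  have hVcl : ∀ n, IsClassicalNSSolutionOn (Ioo (-(tn n / c n ^ 2)) ((ν * T - tn n) / c n ^ 2)) 1 0
      (V n) (c n ^ 2 • stPull (c n ^ 2) (c n) (tn n) (xn n) q) := fun n =>
    (hclw.nsRescale_translate_zero (hcpos n) (tn n) (xn n)).mono
      (fun _ hs => zoom_time_mem (hcpos n).ne' hs) (uniqueDiffOn_Ioo _ _)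
  have hBpos : ∀ n, 0 < (ν * T - tn n) / c n ^ 2 := fun n =>
    div_pos (by linarith [(htn n).2]) (pow_pos (hcpos n) 2)
  have hVslice : ∀ n, ∀ s ∈ Ioc (-(tn n / c n ^ 2)) 0, Continuous (V n s) := fun n s hs =>
    ((hVcl n).contDiff_velocity ⟨hs.1, hs.2.trans_lt (hBpos n)⟩).continuous
  have hVdiv : ∀ n, ∀ s ∈ Ioc (-(tn n / c n ^ 2)) 0, IsWeaklyDivFree (V n s) := fun n s hs =>
    VectorCalculus.IsDivFree.isWeaklyDivFree_holds ((hVcl n).divFree s ⟨hs.1, hs.2.trans_lt (hBpos n)⟩)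
      (contDiff_infty.1 ((hVcl n).contDiff_velocity ⟨hs.1, hs.2.trans_lt (hBpos n)⟩) 1)
  -- for a fixed `t ≤ 0`, the tail of the sequence lives on `(A_n, 0]`
  have htail : ∀ t : ℝ, ∃ N : ℕ, ∀ n, N ≤ n → -(tn n / c n ^ 2) < t := fun t =>
    eventually_atTop.1 (hA.eventually (eventually_lt_atBot t))
  -- ### Step 4: Oseen identity, weak divergence-freeness, the ancient mild class
  have hos := zoom_limit_oseen_identity (ν * T) w q hνT hclw K₀ hK₀top hK₀b v tn xn c htn hcpos hA
    hVbd hVlim hvcont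
  have hdivv : ∀ t < 0, IsWeaklyDivFree (v t) := by
    intro t ht
    obtain ⟨N, hN⟩ := htail t
    have hmem : ∀ k, t ∈ Ioc (-(tn (k + N) / c (k + N) ^ 2)) 0 := fun k =>
      ⟨hN (k + N) (Nat.le_add_left N k), ht.le⟩
    exact isWeaklyDivFree_of_tendsto_of_bound (a := fun k => V (k + N) t) (M := 2)
      (fun k => hVdiv (k + N) t (hmem k)) (fun k => hVslice (k + N) t (hmem k))
      (fun k x => hVbd (k + N) t (hmem k) x) (fun x => (hVlim t ht.le x).comp (tendsto_add_atTop_nat N))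
  obtain ⟨hmild, hsmooth, hmeasv⟩ := zoom_limit_isBoundedAncientMildSolution v hvcont hvbd hdivv hos
  -- ### Step 5: the planar bound
  have hplanar_w : ∀ s ∈ Ioc 0 (ν * T), s < ν * T →
      ∀ (R : EuclideanSpace ℝ (Fin 3) ≃ₗᵢ[ℝ] EuclideanSpace ℝ (Fin 3)) (h : ℝ),
        ∫⁻ y : EuclideanSpace ℝ (Fin 2), ‖w s (R (toLp 2 ![y 0, y 1, h]))‖ₑ ^ 2 ≤
          ENNReal.ofReal (ν⁻¹ ^ 2 * M) := by
    intro s hs hsT R h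
    have ht : ν⁻¹ * s ∈ Ico 0 T := ⟨mul_nonneg hν'.le hs.1.le, (hmaps ⟨hs.1, hsT⟩).2⟩
    have h1 : ∀ y : EuclideanSpace ℝ (Fin 2), ‖w s (R (toLp 2 ![y 0, y 1, h]))‖ₑ ^ 2 =
        ENNReal.ofReal (ν⁻¹ ^ 2) * ‖u (ν⁻¹ * s) (R (toLp 2 ![y 0, y 1, h]))‖ₑ ^ 2 := by
      intro y
      rw [hw_apply, enorm_smul, mul_pow, Real.enorm_eq_ofReal hν'.le, ENNReal.ofReal_pow hν'.le]
    simp_rw [h1]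
    rw [lintegral_const_mul' _ _ ENNReal.ofReal_ne_top, ENNReal.ofReal_mul (by positivity)]
    gcongr
    exact hM _ ht R h
  have hplanar_V : ∀ n, ∀ s ∈ Ioc (-(tn n / c n ^ 2)) 0,
      ∀ (R : EuclideanSpace ℝ (Fin 3) ≃ₗᵢ[ℝ] EuclideanSpace ℝ (Fin 3)) (h : ℝ),
        ∫⁻ y : EuclideanSpace ℝ (Fin 2), ‖V n s (R (toLp 2 ![y 0, y 1, h]))‖ₑ ^ 2 ≤
          ENNReal.ofReal (ν⁻¹ ^ 2 * M) := by
    intro n s hs R h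
    have hτ := zoom_time_mem_Ioc (t₀ := tn n) (hcpos n).ne' hs
    have heq : ∀ y : EuclideanSpace ℝ (Fin 2), V n s (R (toLp 2 ![y 0, y 1, h])) =
        c n • w (tn n + c n ^ 2 * s) (xn n + c n • R (toLp 2 ![y 0, y 1, h])) := fun y => by
      simp only [hVdef, smul_stPull_apply]
    simp_rw [heq]
    rw [planarEnergy_zoom_eq (w (tn n + c n ^ 2 * s)) (xn n) (c n) (hcpos n) R h]
    exact hplanar_w _ ⟨hτ.1, hτ.2.trans (htn n).2.le⟩ (hτ.2.trans_lt (htn n).2) R _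
  have hplanar_v : ∀ t ≤ 0, ∀ (R : EuclideanSpace ℝ (Fin 3) ≃ₗᵢ[ℝ] EuclideanSpace ℝ (Fin 3)) (h : ℝ),
      ∫⁻ y : EuclideanSpace ℝ (Fin 2), ‖v t (R (toLp 2 ![y 0, y 1, h]))‖ₑ ^ 2 ≤
        ENNReal.ofReal (ν⁻¹ ^ 2 * M) := by
    intro t ht R h
    obtain ⟨N, hN⟩ := htail t
    have hmem : ∀ k, t ∈ Ioc (-(tn (k + N) / c (k + N) ^ 2)) 0 := fun k =>
      ⟨hN (k + N) (Nat.le_add_left N k), ht⟩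
    exact planarEnergy_le_of_tendsto (fun k => V (k + N) t) (v t) (fun k => hVslice (k + N) t (hmem k))
      (fun x => (hVlim t ht x).comp (tendsto_add_atTop_nat N)) R h (ENNReal.ofReal (ν⁻¹ ^ 2 * M))
      (fun k => hplanar_V (k + N) t (hmem k) R h)
  -- ### conclusion
  exact ⟨v, ν⁻¹ ^ 2 * M, hmild, hmeasv, hsmooth, fun t ht R h => hplanar_v t ht.le R h, hnz⟩

end Summit.NavierStokesRegularity.NavierStokesRegularity.Theorems.BoundedPlanarEnergyRegularity

end
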